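import Mathlib.NumberTheory.ModularForms.NormTrace
import Mathlib.NumberTheory.ModularForms.CongruenceSubgroups
import Mathlib.NumberTheory.ModularForms.QExpansion
import Mathlib.NumberTheory.DirichletCharacter.Basic
import Mathlib.FieldTheory.IntermediateField.Adjoin.Basic
import Mathlib.RingTheory.IntegralClosure.IsIntegral.Basic
import Literature.NumberTheory.EllipticCurves.HeckeOperators
import HarnessLib

-- provenance: harness21/H21/H21/Prelude/EllArithM/Newforms.lean @ c717367 (interim HEAD d8f2665); M5 mechanical rewrite
/-!
# Eigenforms, oldforms and newforms (trunk EllArithM, outline item C6 / work item G16:Newforms)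

Atkin–Lehner–Li theory of newforms for the congruence subgroups `Γ₀(N)` and `Γ₁(N)`, stated on
Mathlib's `CuspForm Γ k` and built on the Hecke correspondences of
`Literature.Prelude.EllArithM.HeckeOperators` (item C5).

## Main definitions (namespace `Literature.ModularForms`)

* `IsHeckeEigenform f`: `f` is an eigenvector of every `T_p`, `p` prime; `heckeEigenvalue f p`.
* `IsNormalized f`: `a_1(f) = 1` (period-`1` expansion; generic in the level `Γ`).
* `degeneracyMap0 M N d k : S_k(Γ₀(M)) →ₗ[ℂ] S_k(Γ₀(N))`, the degeneracy map `f ↦ f ∣ diag(d, 1)`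
  ("`f(τ) ↦ f(dτ)`" up to a constant), and its adjoint `adjDegeneracyMap0`; the versions
  `degeneracyMap1`, `adjDegeneracyMap1` for `Γ₁`. All four are one-line specialisations of the
  generic `cuspHeckeCorrespondenceₗ`.
* `oldSubspace0 N k`, `newSubspace0 N k` (and `…1`): the old subspace is the span of the images of
  the degeneracy maps from levels `M ∣ N`, `M < N`; the **new subspace is defined algebraically**
  as the joint kernel of the adjoint degeneracy maps to lower levels. That it is the Petersson
  orthogonal complement of the old subspace is the theorem `newSubspace0_eq_orthogonal`
  (Atkin–Lehner 1970, Thm. 5 / Li 1975, Thm. 3).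
* `IsNewform0 f`, `newforms0 N k`, `IsNewform1 f`, `newforms1 N k`: normalised new eigenforms.
* `nebentypusSubspace N k χ = S_k(N, χ)`, `nebentypus f`.
* `coeffField f`: the field generated over `ℚ` by the `q`-expansion coefficients.
* `liftToGamma1 : S_k(Γ₀(N)) →ₗ[ℂ] S_k(Γ₁(N))`, the inclusion.

## Design notes

* Two thin variants (suffix `0` / `1`) are kept rather than one definition over a level family
  `ℕ → Subgroup (GL (Fin 2) ℝ)`: such a family admits no uniform `Subgroup.IsArithmetic` instance
  since `Gamma0 0` (the Borel `{c = 0}` of `SL(2, ℤ)`) has infinite index (OUTLINE, review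
  response 9b). Throughout `[NeZero N]`.
* In `oldSubspace0` etc. the instances `NeZero M`, `NeZero d` for an index `(M, d)` (`M` a proper
  divisor of `N`, `M d ∣ N`) are genuine instances on the subtype `DegeneracyIndex N`
  (from `Nat.pos_of_mem_properDivisors`), so `IsArithmetic (Gamma0 M)` is found honestly
  (review 9f).
* `q`-expansions are taken with period `1` (`qExpansion 1 ⇑f`); both `Γ₀(N)` and `Γ₁(N)` contain
  `T = (1 1; 0 1)` (cf. Mathlib `CongruenceSubgroup.strictWidthInfty_Gamma0`,
  `strictWidthInfty_Gamma1`).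
* Mathlib has no eigenforms/newforms (searched `Eigenform`, `newform`, `oldform`): everything
  here is new, but only glue over Mathlib's `CuspForm`, `qExpansion`, `DirichletCharacter`,
  `IntermediateField.adjoin`.

## References

* A. O. L. Atkin, J. Lehner, *Hecke operators on `Γ₀(m)`*, Math. Ann. 185 (1970), 134–160.
* W.-C. W. Li, *Newforms and functional equations*, Math. Ann. 212 (1975), 285–315.
* F. Diamond, J. Shurman, *A first course in modular forms*, GTM 228, 2005, §5.6–5.8.
* T. Miyake, *Modular forms*, Springer, 1989, §4.6.
-/

noncomputable section

open scoped MatrixGroups ModularForm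

open CongruenceSubgroup UpperHalfPlane

namespace Literature.NumberTheory.EllipticCurves.ModularForms

/-! ### Eigenforms and normalisation -/

section Eigen

variable {Γ : Subgroup (GL (Fin 2) ℝ)} [Γ.IsArithmetic] [Γ.HasDetOne] {k : ℤ}

/-- A cusp form `f ∈ S_k(Γ)` is a **Hecke eigenform** if it is an eigenvector of the Hecke
operator `T_p = [Γ diag(1, p) Γ]` for every prime `p` (Diamond–Shurman Def. 5.8.1; for `p`
dividing the level `T_p` is the operator `U_p`). We do not require `f ≠ 0` here; newforms are
nonzero by the normalisation `a_1 = 1`. [folklore] -/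
def IsHeckeEigenform (f : CuspForm Γ k) : Prop :=
  ∀ p : ℕ, (hp : p.Prime) → ∃ a : ℂ, (haveI : NeZero p := ⟨hp.ne_zero⟩; heckeT Γ k p f) = a • f

open Classical in
/-- The **Hecke eigenvalue** `a_p(f)` of `f` for `T_p`: the scalar `a` with `T_p f = a • f` if it
exists (and `p ≠ 0`), and the junk value `0` otherwise. For `f = 0` every scalar works and the
chosen one is unspecified (Diamond–Shurman Def. 5.8.1). [folklore] -/
def heckeEigenvalue (f : CuspForm Γ k) (p : ℕ) : ℂ :=
  if h : ∃ hp : p ≠ 0, ∃ a : ℂ, (haveI : NeZero p := ⟨hp⟩; heckeT Γ k p f) = a • f then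
    h.choose_spec.choose else 0

/-- Defining property of `heckeEigenvalue`: if `f` is a `T_p`-eigenvector then
`T_p f = a_p(f) • f`. [folklore] -/
theorem heckeT_eq_heckeEigenvalue_smul (f : CuspForm Γ k) (p : ℕ) [NeZero p]
    (h : ∃ a : ℂ, heckeT Γ k p f = a • f) :
    heckeT Γ k p f = heckeEigenvalue f p • f := by
  have h' : ∃ hp : p ≠ 0, ∃ a : ℂ, heckeT Γ k p f = a • f := ⟨NeZero.ne p, h⟩
  rw [heckeEigenvalue, dif_pos h']
  exact h'.choose_spec.choose_spec

/-- A cusp form `f ∈ S_k(Γ)` is **normalised** if its first Fourier coefficient is `1`: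
`a_1(f) = 1`, where `f = ∑ a_n qⁿ`, `q = e^{2πiτ}` (Diamond–Shurman Def. 5.8.1). This uses the
period-`1` `q`-expansion and is meaningful for levels containing `T = (1 1; 0 1)`, e.g. `Γ₀(N)`,
`Γ₁(N)` (Mathlib `CongruenceSubgroup.strictWidthInfty_Gamma0/1`); it needs no arithmeticity
hypothesis on `Γ`. [folklore] -/
def IsNormalized {Γ : Subgroup (GL (Fin 2) ℝ)} {k : ℤ} (f : CuspForm Γ k) : Prop :=
  (qExpansion 1 ⇑f).coeff 1 = 1

end Eigen

/-! ### Degeneracy maps, old and new subspaces for `Γ₀(N)` -/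

section Gamma0

/-- The **degeneracy map** `S_k(Γ₀(M)) → S_k(Γ₀(N))` attached to `d`: the Hecke correspondence
`[Γ₀(M) diag(d, 1) Γ₀(N)]`, i.e. (a constant multiple of) `f(τ) ↦ f(dτ)`. It is the classical
degeneracy map when `M d ∣ N`; the definition is total in `(M, N, d)` and has no arithmetic
meaning otherwise (Atkin–Lehner 1970, §2; Diamond–Shurman §5.6, the maps `ι_d`). [cite: AtkinLehner1970, §2] -/
def degeneracyMap0 (M N d : ℕ) [NeZero M] [NeZero N] [NeZero d] (k : ℤ) :
    CuspForm (Gamma0 M) k →ₗ[ℂ] CuspForm (Gamma0 N) k :=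
  cuspHeckeCorrespondenceₗ (Gamma0 M) (Gamma0 N) k
    (diagGL d 1 (Nat.cast_pos.mpr (NeZero.pos d)) one_pos)

/-- The **adjoint degeneracy map** `S_k(Γ₀(N)) → S_k(Γ₀(M))` attached to `d`: the Hecke
correspondence `[Γ₀(N) diag(1, d) Γ₀(M)]`, adjoint to `degeneracyMap0 M N d k` for the Petersson
product when `M d ∣ N` (Li 1975, §2, Lemma 5; Diamond–Shurman Ex. 5.7.2). [cite: Li1975, §2  Lemma 5] -/
def adjDegeneracyMap0 (N M d : ℕ) [NeZero N] [NeZero M] [NeZero d] (k : ℤ) :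
    CuspForm (Gamma0 N) k →ₗ[ℂ] CuspForm (Gamma0 M) k :=
  cuspHeckeCorrespondenceₗ (Gamma0 N) (Gamma0 M) k
    (diagGL 1 d one_pos (Nat.cast_pos.mpr (NeZero.pos d)))

variable (N : ℕ) [NeZero N] (k : ℤ)

/-- The index set of degeneracy data at level `N`: pairs `(M, d)` with `M` a proper divisor of
`N` and `M d ∣ N`. [folklore] -/
abbrev DegeneracyIndex : Type :=
  {x : ℕ × ℕ // x.1 ∈ N.properDivisors ∧ x.1 * x.2 ∣ N}

omit [NeZero N] in
/-- The level component `M` of a degeneracy index `(M, d)` is nonzero (it is a proper divisor of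
`N`). An instance on the H21 subtype `DegeneracyIndex N` (no Mathlib instance is shadowed), so
that `Subgroup.IsArithmetic (Gamma0 M)` is found by instance search below (review 9f). [folklore] -/
instance DegeneracyIndex.neZero_fst (Md : DegeneracyIndex N) : NeZero Md.1.1 :=
  ⟨(Nat.pos_of_mem_properDivisors Md.2.1).ne'⟩

/-- The `d`-component of a degeneracy index `(M, d)` is nonzero (since `M d ∣ N ≠ 0`). [folklore] -/
instance DegeneracyIndex.neZero_snd (Md : DegeneracyIndex N) : NeZero Md.1.2 :=
  ⟨fun h ↦ NeZero.ne N (Nat.eq_zero_of_zero_dvd (by simpa [h] using Md.2.2))⟩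

/-- The **old subspace** `S_k(Γ₀(N))^{old}`: the span of the images of all degeneracy maps
`S_k(Γ₀(M)) → S_k(Γ₀(N))`, `f ↦ f ∣ diag(d, 1)`, over proper divisors `M` of `N` and `d` with
`M d ∣ N` (Atkin–Lehner 1970, §2; Diamond–Shurman Def. 5.6.1). [cite: AtkinLehner1970, §2] -/
def oldSubspace0 : Submodule ℂ (CuspForm (Gamma0 N) k) :=
  ⨆ Md : DegeneracyIndex N,
    LinearMap.range (degeneracyMap0 Md.1.1 N Md.1.2 k)

/-- The **new subspace** `S_k(Γ₀(N))^{new}`, defined *algebraically* as the joint kernel of all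
adjoint degeneracy maps `S_k(Γ₀(N)) → S_k(Γ₀(M))` to lower levels `M ∣ N`, `M < N`, `M d ∣ N`.
By Atkin–Lehner 1970, Thm. 5 / Li 1975, Thm. 3 (cf. Diamond–Shurman Def. 5.6.1, Ex. 5.7.2) this
is the Petersson orthogonal complement of `oldSubspace0 N k`; see
`newSubspace0_eq_orthogonal`. [cite: AtkinLehner1970, Thm. 5 / Li 1975  Thm. 3 (cf. Diamond–Sh] -/
def newSubspace0 : Submodule ℂ (CuspForm (Gamma0 N) k) :=
  ⨅ Md : DegeneracyIndex N,
    LinearMap.ker (adjDegeneracyMap0 N Md.1.1 Md.1.2 k)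

variable {N k}

/-- A **newform** of level `Γ₀(N)` and weight `k`: a normalised (`a_1 = 1`) Hecke eigenform in
the new subspace (Atkin–Lehner 1970, §4; Diamond–Shurman Def. 5.8.1). [cite: AtkinLehner1970, §4] -/
def IsNewform0 (f : CuspForm (Gamma0 N) k) : Prop :=
  f ∈ newSubspace0 N k ∧ IsHeckeEigenform f ∧ IsNormalized f

variable (N k)

/-- The set of newforms in `S_k(Γ₀(N))` (Diamond–Shurman Def. 5.8.1). [folklore] -/
def newforms0 : Set (CuspForm (Gamma0 N) k) :=
  {f | IsNewform0 f}

end Gamma0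

/-! ### Degeneracy maps, old and new subspaces, nebentypus for `Γ₁(N)` -/

section Gamma1

/-- The **degeneracy map** `S_k(Γ₁(M)) → S_k(Γ₁(N))` attached to `d`: the Hecke correspondence
`[Γ₁(M) diag(d, 1) Γ₁(N)]` (meaningful for `M d ∣ N`; total definition otherwise, cf.
`degeneracyMap0`) (Li 1975, §2; Diamond–Shurman §5.6, `ι_d`). [cite: Li1975, §2] -/
def degeneracyMap1 (M N d : ℕ) [NeZero M] [NeZero N] [NeZero d] (k : ℤ) :
    CuspForm (Gamma1 M) k →ₗ[ℂ] CuspForm (Gamma1 N) k :=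
  cuspHeckeCorrespondenceₗ (Gamma1 M) (Gamma1 N) k
    (diagGL d 1 (Nat.cast_pos.mpr (NeZero.pos d)) one_pos)

/-- The **adjoint degeneracy map** `S_k(Γ₁(N)) → S_k(Γ₁(M))` attached to `d`: the Hecke
correspondence `[Γ₁(N) diag(1, d) Γ₁(M)]` (Li 1975, §2, Lemma 5; Diamond–Shurman Ex. 5.7.2). [cite: Li1975, §2  Lemma 5] -/
def adjDegeneracyMap1 (N M d : ℕ) [NeZero N] [NeZero M] [NeZero d] (k : ℤ) :
    CuspForm (Gamma1 N) k →ₗ[ℂ] CuspForm (Gamma1 M) k :=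
  cuspHeckeCorrespondenceₗ (Gamma1 N) (Gamma1 M) k
    (diagGL 1 d one_pos (Nat.cast_pos.mpr (NeZero.pos d)))

variable (N : ℕ) [NeZero N] (k : ℤ)

/-- The **old subspace** `S_k(Γ₁(N))^{old}`: span of the images of the degeneracy maps from
levels `Γ₁(M)`, `M` a proper divisor of `N`, `M d ∣ N` (Li 1975, §2; Diamond–Shurman
Def. 5.6.1). [cite: Li1975, §2] -/
def oldSubspace1 : Submodule ℂ (CuspForm (Gamma1 N) k) :=
  ⨆ Md : DegeneracyIndex N,
    LinearMap.range (degeneracyMap1 Md.1.1 N Md.1.2 k)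

/-- The **new subspace** `S_k(Γ₁(N))^{new}`, defined algebraically as the joint kernel of the
adjoint degeneracy maps to lower levels; equal to the Petersson orthogonal complement of
`oldSubspace1 N k` by Li 1975, Thm. 3 (Diamond–Shurman Def. 5.6.1, Ex. 5.7.2). [cite: Li1975, Thm. 3 (Diamond–Shurman Def. 5.6.1  Ex] -/
def newSubspace1 : Submodule ℂ (CuspForm (Gamma1 N) k) :=
  ⨅ Md : DegeneracyIndex N,
    LinearMap.ker (adjDegeneracyMap1 N Md.1.1 Md.1.2 k)

/-- The **`χ`-eigenspace of the diamond operators**, `S_k(N, χ) ⊆ S_k(Γ₁(N))`: cusp forms with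
`⟨d⟩ f = χ(d) f` for all `d ∈ (ℤ/Nℤ)ˣ` (Diamond–Shurman §4.3, p. 119 and §5.2, p. 169:
`S_k(Γ₁(N)) = ⊕_χ S_k(N, χ)`). [folklore] -/
def nebentypusSubspace (χ : DirichletCharacter ℂ N) : Submodule ℂ (CuspForm (Gamma1 N) k) :=
  ⨅ d : (ZMod N)ˣ, LinearMap.ker (diamondOp N k (d : ZMod N) - χ (d : ZMod N) • LinearMap.id)

variable {N k}

/-- A **newform** of level `Γ₁(N)` and weight `k`: a normalised Hecke eigenform in the new
subspace which is also an eigenvector of all diamond operators `⟨d⟩`, `d ∈ (ℤ/Nℤ)ˣ`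
(Li 1975, §3; Diamond–Shurman Def. 5.8.1). [cite: Li1975, §3] -/
def IsNewform1 (f : CuspForm (Gamma1 N) k) : Prop :=
  f ∈ newSubspace1 N k ∧ IsHeckeEigenform f ∧
    (∀ d : (ZMod N)ˣ, ∃ c : ℂ, diamondOp N k (d : ZMod N) f = c • f) ∧ IsNormalized f

variable (N k)

/-- The set of newforms in `S_k(Γ₁(N))` (Diamond–Shurman Def. 5.8.1). [folklore] -/
def newforms1 : Set (CuspForm (Gamma1 N) k) :=
  {f | IsNewform1 f}

variable {N k}

open Classical in
/-- The **nebentypus** (character) of `f ∈ S_k(Γ₁(N))`: a Dirichlet character `χ` mod `N` with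
`f ∈ S_k(N, χ)`, if one exists (it is unique when `f ≠ 0`); the junk value `1` otherwise
(Diamond–Shurman §4.3, §5.2). [folklore] -/
def nebentypus (f : CuspForm (Gamma1 N) k) : DirichletCharacter ℂ N :=
  if h : ∃ χ : DirichletCharacter ℂ N, f ∈ nebentypusSubspace N k χ then h.choose else 1

end Gamma1

/-! ### Coefficient field, change of level `Γ₀(N) → Γ₁(N)` -/

section CoeffField

variable {Γ : Subgroup (GL (Fin 2) ℝ)} {k : ℤ}

/-- The **coefficient field** `K_f = ℚ(a_n(f) : n ≥ 0)` of a cusp form: the subfield of `ℂ`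
generated by its `q`-expansion coefficients (period-`1` expansion; meaningful for levels
containing `T`, e.g. `Γ₀(N)`, `Γ₁(N)`) (Diamond–Shurman Def. 6.5.3; Shimura 1971, Thm. 3.48). [cite: Shimura1971, Thm. 3.48] -/
def coeffField (f : CuspForm Γ k) : IntermediateField ℚ ℂ :=
  IntermediateField.adjoin ℚ (Set.range fun n : ℕ ↦ (qExpansion 1 ⇑f).coeff n)

/-- Each `q`-expansion coefficient lies in the coefficient field (by definition). [folklore] -/
lemma coeff_mem_coeffField (f : CuspForm Γ k) (n : ℕ) : (qExpansion 1 ⇑f).coeff n ∈ coeffField f :=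
  IntermediateField.subset_adjoin ℚ _ ⟨n, rfl⟩

end CoeffField

section Lift

variable (N : ℕ) [NeZero N] (k : ℤ)

/-- The inclusion `S_k(Γ₀(N)) ↪ S_k(Γ₁(N))` (`Γ₁(N) ≤ Γ₀(N)`), realised as the level-restriction
Hecke correspondence `[Γ₀(N) 1 Γ₁(N)]` of item C5; its image is `S_k(N, 𝟙)`
(Diamond–Shurman §4.3, §5.2). [folklore] -/
def liftToGamma1 : CuspForm (Gamma0 N) k →ₗ[ℂ] CuspForm (Gamma1 N) k :=
  restrictLevel (Gamma0 N) (Gamma1 N) k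

/-- `liftToGamma1` does not change the underlying function on `ℍ`. [folklore] -/
def coe_liftToGamma1 : Prop :=
  ∀ (f : CuspForm (Gamma0 N) k),
    (⇑(liftToGamma1 N k f) : ℍ → ℂ) = ⇑f

/- interim proof relied on results that are now named facts (D-0014); demoted to a fact by the M5 import, proof preserved:
:=
  restrictLevel_apply_coe _ _ k
    (by exact_mod_cast Subgroup.map_mono (Gamma1_in_Gamma0 N)) f
-/

end Lift

/-! ### Structural theorems (Atkin–Lehner–Li theory; proofs deferred) -/

section Theorems

variable (N : ℕ) [NeZero N] (k : ℤ)

/-- **Atkin–Lehner / Li:** the algebraically defined new subspace is the Petersson orthogonal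
complement of the old subspace in `S_k(Γ₀(N))` (Atkin–Lehner 1970, Thm. 5 with Lemma 13;
Li 1975, Thm. 3; Diamond–Shurman Def. 5.6.1 with Prop. 5.5.2 and Ex. 5.7.2). [cite: AtkinLehner1970, Thm. 5 with Lemma 13] -/
def newSubspace0_eq_orthogonal : Prop :=
  (newSubspace0 N k : Set (CuspForm (Gamma0 N) k)) =
      {f | ∀ g ∈ oldSubspace0 N k, peterssonProduct (Gamma0 N) k f g = 0}

/-- `S_k(Γ₀(N)) = S_k(Γ₀(N))^{old} ⊕ S_k(Γ₀(N))^{new}`, spanning part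
(Diamond–Shurman §5.6, p. 188; Atkin–Lehner 1970, Thm. 5). [cite: AtkinLehner1970, Thm. 5] -/
def oldSubspace0_sup_newSubspace0 : Prop :=
  oldSubspace0 N k ⊔ newSubspace0 N k = ⊤

/-- `S_k(Γ₀(N)) = S_k(Γ₀(N))^{old} ⊕ S_k(Γ₀(N))^{new}`, disjointness part
(Diamond–Shurman §5.6, p. 188; Atkin–Lehner 1970, Thm. 5). [cite: AtkinLehner1970, Thm. 5] -/
def disjoint_oldSubspace0_newSubspace0 : Prop :=
  Disjoint (oldSubspace0 N k) (newSubspace0 N k)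

/-- **Li:** the algebraically defined new subspace of `S_k(Γ₁(N))` is the Petersson orthogonal
complement of the old subspace (Li 1975, Thm. 3 with Lemma 5; Diamond–Shurman Def. 5.6.1,
Prop. 5.5.2, Ex. 5.7.2). [cite: Li1975, Thm. 3 with Lemma 5] -/
def newSubspace1_eq_orthogonal : Prop :=
  (newSubspace1 N k : Set (CuspForm (Gamma1 N) k)) =
      {f | ∀ g ∈ oldSubspace1 N k, peterssonProduct (Gamma1 N) k f g = 0}

/-- The analogue for `Γ₁(N)`: `S_k(Γ₁(N)) = S_k(Γ₁(N))^{old} ⊕ S_k(Γ₁(N))^{new}`, spanning part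
(Li 1975, Thm. 3; Diamond–Shurman §5.6). [cite: Li1975, Thm. 3] -/
def oldSubspace1_sup_newSubspace1 : Prop :=
  oldSubspace1 N k ⊔ newSubspace1 N k = ⊤

/-- `S_k(Γ₁(N)) = S_k(Γ₁(N))^{old} ⊕ S_k(Γ₁(N))^{new}`, disjointness part
(Li 1975, Thm. 3; Diamond–Shurman §5.6). [cite: Li1975, Thm. 3] -/
def disjoint_oldSubspace1_newSubspace1 : Prop :=
  Disjoint (oldSubspace1 N k) (newSubspace1 N k)

/-- There are only finitely many newforms of given level `Γ₀(N)` and weight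
(Atkin–Lehner 1970, Thm. 5; Diamond–Shurman Thm. 5.8.3: they form a basis of the
finite-dimensional new subspace). [cite: AtkinLehner1970, Thm. 5] -/
def finite_newforms0 : Prop :=
  (newforms0 N k).Finite

/-- Newforms of level `Γ₀(N)` are linearly independent (Diamond–Shurman Thm. 5.8.3;
Atkin–Lehner 1970, Thm. 5). [cite: AtkinLehner1970, Thm. 5] -/
def linearIndependent_newforms0 : Prop :=
  LinearIndependent ℂ (Subtype.val : newforms0 N k → CuspForm (Gamma0 N) k)

/-- **Multiplicity one:** the newforms span the new subspace, hence (with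
`linearIndependent_newforms0`) form a basis of `S_k(Γ₀(N))^{new}` (Atkin–Lehner 1970, Thm. 5;
Diamond–Shurman Thm. 5.8.3). [cite: AtkinLehner1970, Thm. 5] -/
def span_newforms0 : Prop :=
  Submodule.span ℂ (newforms0 N k) = newSubspace0 N k

/-- Multiplicity one for `Γ₁(N)`: the newforms span `S_k(Γ₁(N))^{new}` (Li 1975, Thm. 3 and
Cor. 3; Diamond–Shurman Thm. 5.8.3). [cite: Li1975, Thm. 3 and Cor. 3] -/
def span_newforms1 : Prop :=
  Submodule.span ℂ (newforms1 N k) = newSubspace1 N k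

variable {N k}

/-- **Strong multiplicity one** (same level): two newforms in `S_k(Γ₀(N))` whose Hecke
eigenvalues `a_p` agree for all but finitely many primes `p` are equal (Atkin–Lehner 1970,
Thm. 4 and Lemma 26; Diamond–Shurman Thm. 5.8.2 / Ex. 5.8.4; Miyake Thm. 4.6.19). [cite: AtkinLehner1970, Thm. 4 and Lemma 26] -/
def IsNewform0.eq_of_heckeEigenvalue_eq : Prop :=
  ∀ {f g : CuspForm (Gamma0 N) k} (hf : IsNewform0 f) (hg : IsNewform0 g) (h : {p : ℕ | p.Prime ∧ heckeEigenvalue f p ≠ heckeEigenvalue g p}.Finite),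
    f = g

/-- **Strong multiplicity one** across levels: newforms of levels `Γ₀(N)`, `Γ₀(N')` (same weight)
with the same Hecke eigenvalues at all but finitely many primes have the same level (and then
coincide, `IsNewform0.eq_of_heckeEigenvalue_eq`) (Atkin–Lehner 1970, Thm. 4; Li 1975, Cor. 3 of
Thm. 3; Miyake Thm. 4.6.19). [cite: AtkinLehner1970, Thm. 4] -/
def IsNewform0.level_eq_of_heckeEigenvalue_eq : Prop :=
  ∀ {N' : ℕ} [NeZero N'] {f : CuspForm (Gamma0 N) k} {g : CuspForm (Gamma0 N') k} (hf : IsNewform0 f) (hg : IsNewform0 g) (h : {p : ℕ | p.Prime ∧ heckeEigenvalue f p ≠ heckeEigenvalue g p}.Finite),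
    N = N'

/-- For a newform, the `T_p`-eigenvalue is the `p`-th Fourier coefficient: `T_p f = a_p(f) f`
for every prime `p` (including `p ∣ N`, where `T_p = U_p`) (Atkin–Lehner 1970, Thm. 3;
Diamond–Shurman Prop. 5.8.5 / Thm. 5.8.2). [cite: AtkinLehner1970, Thm. 3] -/
def IsNewform0.heckeEigenvalue_eq_coeff : Prop :=
  ∀ {f : CuspForm (Gamma0 N) k} (hf : IsNewform0 f) {p : ℕ} (hp : p.Prime),
    heckeEigenvalue f p = (qExpansion 1 ⇑f).coeff p

/-- The Fourier coefficients of a newform are multiplicative: `a_{mn} = a_m a_n` for coprime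
`m, n` (Atkin–Lehner 1970, Thm. 3; Diamond–Shurman Thm. 5.8.2 with Prop. 5.8.5). [cite: AtkinLehner1970, Thm. 3] -/
def IsNewform0.coeff_mul_of_coprime : Prop :=
  ∀ {f : CuspForm (Gamma0 N) k} (hf : IsNewform0 f) {m n : ℕ} (hmn : m.Coprime n),
    (qExpansion 1 ⇑f).coeff (m * n) = (qExpansion 1 ⇑f).coeff m * (qExpansion 1 ⇑f).coeff n

/-- The coefficient field of a newform is a number field (finite over `ℚ`)
(Diamond–Shurman Thm. 6.5.1 and Def. 6.5.3; Shimura 1971, Thm. 3.48). [cite: Shimura1971, Thm. 3.48] -/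
def IsNewform0.finiteDimensional_coeffField : Prop :=
  ∀ {f : CuspForm (Gamma0 N) k} (hf : IsNewform0 f),
    FiniteDimensional ℚ (coeffField f)

/-- The Fourier coefficients of a newform are algebraic integers
(Diamond–Shurman Thm. 6.5.1; Shimura 1971, Thm. 3.48). [cite: Shimura1971, Thm. 3.48] -/
def IsNewform0.isIntegral_coeff : Prop :=
  ∀ {f : CuspForm (Gamma0 N) k} (hf : IsNewform0 f) (n : ℕ),
    IsIntegral ℤ ((qExpansion 1 ⇑f).coeff n)

/-- The coefficient field of a `Γ₁(N)`-newform is a number field (Diamond–Shurman Thm. 6.5.1;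
Shimura 1971, Thm. 3.48). [cite: Shimura1971, Thm. 3.48] -/
def IsNewform1.finiteDimensional_coeffField : Prop :=
  ∀ {f : CuspForm (Gamma1 N) k} (hf : IsNewform1 f),
    FiniteDimensional ℚ (coeffField f)

/-- A `Γ₁(N)`-newform lies in the eigenspace `S_k(N, χ)` of its nebentypus `χ = nebentypus f`,
i.e. `⟨d⟩ f = χ(d) f` for all `d ∈ (ℤ/Nℤ)ˣ` (Diamond–Shurman §4.3 and §5.2, p. 169;
Li 1975, §3). [cite: Li1975, §3] -/
def IsNewform1.mem_nebentypusSubspace_nebentypus : Prop :=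
  ∀ {f : CuspForm (Gamma1 N) k} (hf : IsNewform1 f),
    f ∈ nebentypusSubspace N k (nebentypus f)

/-- For a `Γ₁(N)`-newform, `T_p f = a_p(f) f` for every prime `p` (Diamond–Shurman Thm. 5.8.2,
Prop. 5.8.5; Li 1975, Thm. 3). [cite: Li1975, Thm. 3] -/
def IsNewform1.heckeEigenvalue_eq_coeff : Prop :=
  ∀ {f : CuspForm (Gamma1 N) k} (hf : IsNewform1 f) {p : ℕ} (hp : p.Prime),
    heckeEigenvalue f p = (qExpansion 1 ⇑f).coeff p

/-- Newforms on `Γ₀(N)` are exactly the newforms on `Γ₁(N)` with trivial nebentypus that come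
from `Γ₀(N)`: `f ∈ S_k(Γ₀(N))` is a newform iff its image in `S_k(Γ₁(N)) = ⊕_χ S_k(N, χ)` is
(Diamond–Shurman §5.2, `S_k(Γ₀(N)) = S_k(N, 𝟙)`, and Thm. 5.8.2; Li 1975, §3). [cite: Li1975, §3] -/
def isNewform1_liftToGamma1_iff : Prop :=
  ∀ (f : CuspForm (Gamma0 N) k),
    IsNewform1 (liftToGamma1 N k f) ↔ IsNewform0 f

/-- The nebentypus of (the lift of) a nonzero `Γ₀(N)`-form is trivial
(Diamond–Shurman §4.3: `S_k(Γ₀(N)) = S_k(N, 𝟙)`). [cite: DiamondShurman2005, §4.3 (S_k(Γ₀(N)) = S_k(N, 𝟙))] -/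
def nebentypus_liftToGamma1 : Prop :=
  ∀ {f : CuspForm (Gamma0 N) k} (hf : f ≠ 0),
    nebentypus (liftToGamma1 N k f) = 1

omit [NeZero N] in
variable (N) in
/-- `-1 ∈ Γ₀(N)` (viewed in `GL(2, ℝ)`), for every `N` (Diamond–Shurman §1.2). [folklore] -/
theorem neg_one_mem_gamma0 :
    (-1 : GL (Fin 2) ℝ) ∈ ((Gamma0 N : Subgroup SL(2, ℤ)) : Subgroup (GL (Fin 2) ℝ)) := by
  refine ⟨-1, by simp [Gamma0_mem], ?_⟩
  ext i j
  simp [Matrix.SpecialLinearGroup.mapGL_coe_matrix, Matrix.one_apply]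

omit [NeZero N] in
variable (N) in
/-- Remark: there are no nonzero cusp forms (indeed no nonzero modular forms) of odd weight on
`Γ₀(N)`, since `-1 ∈ Γ₀(N)` acts by `(-1)^k` (Diamond–Shurman §4.3, p. 119; in particular
`S_1(Γ₀(N)) = 0`, so weight-one newforms only exist on `Γ₁(N)` with odd nebentypus). A corollary
of Mathlib's `ModularForm.eq_zero_of_neg_one_mem`. [folklore] -/
theorem eq_zero_of_odd_weight_gamma0 (hk : Odd k) (f : CuspForm (Gamma0 N) k) : f = 0 := by
  have h := ModularForm.eq_zero_of_neg_one_mem (neg_one_mem_gamma0 N) hk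
    (f : ModularForm (Gamma0 N) k)
  ext z
  simpa using congrArg (fun g : ModularForm (Gamma0 N) k => g z) h

end Theorems

end Literature.NumberTheory.EllipticCurves.ModularForms
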